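import Literature.NumberTheory.Sieve.FractionPhases
import HarnessLib

/-!
# Combining fraction phases and counting a linear congruence (Polymath 8a, §5.3–5.4 tools)

Topic `Literature/NumberTheory/Sieve`, grouping namespace `Polymath8a`; a support file for the named
fact `Literature.NumberTheory.Sieve.mpz_of_lt` (**parity.S29**), continuing `FractionPhases.lean`.
Source: D. H. J. Polymath, arXiv:1402.0811, §5.3 (the phase `Φ_ℓ` (5.23) and the cutoff
`C(n) := 1_{b₁/n = b₂/(n+ℓr) (q₀)}` (5.22): "Observe that, since `q₀` is coprime to `rb₁`, this is the
characteristic function of a union of at most `(b₁ − b₂, q₀, ℓrb₁) ≤ (q₀, ℓ)` congruence classes modulo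
`q₀`") and §5.4, proof of Proposition 5.10 ("we can … express the phase `Φ_ℓ` in the form
`e_r^{(1)}(h/(q₁q₂n)) e_{q₀q₁}^{(2)}(h/(nq₂)) e_{q₂}^{(3)}(h/((n+τ)q₀q₁))` … and this can be written
`Φ₁(n)\overline{Φ₂(n)} = e_{d₁}^{(4)}(c₁/n) e_{d₂}^{(5)}(c₂/(n+τ))`").  We PROVE the elementary tools
behind these two sentences:

* `Polymath8a.eFrac_neg_left`, `Polymath8a.conj_eFrac` — `\overline{e_d(c/m)} = e_d((−c)/m)`;
* `Polymath8a.eFrac_mul_eFrac_of_coprime_moduli` — **combining two one-pole phases at the same pole**: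
  for coprime `m₁, m₂`, `e_{m₁}(A/n) e_{m₂}(B/n) = e_{m₁m₂}((Am₂ + Bm₁)/n)` (Lemma 4.4 backwards; the
  numerator is `≡ A m₂ (mod m₁)`, a unit multiple of `A`, which is what the gcd bookkeeping
  `(c₁, δ₁')/δ₁' ≤ (c₁, r)/r` of Proposition 5.10 uses);
* `Polymath8a.card_filter_mul_eq_zero`, `card_filter_int_mul_eq_zero` — `#{n mod q : q ∣ an} = (a, q)`;
  `Polymath8a.card_filter_mul_sub_le` — the solutions of `an ≡ b (mod q)` number at most `(a, q)`, and
  `(a, q) ∣ (b, q)` if there is one; hence `Polymath8a.card_cutoff_le` — the cutoff `C(n)` is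
  supported on at most `(ℓ, q₀)` classes modulo `q₀` when `(b₁r, q₀) = 1`;
* `Polymath8a.tsum_indicator_classes_eq`, `norm_tsum_indicator_classes_le` —
  `∑_n 1_{∃ t ∈ T, n ≡ t (q)} F(n) = ∑_{t ∈ T} ∑_{n ≡ t (q)} F(n)` for distinct residues `T ⊂ [0, q)`,
  whence `|∑_n C(n) F(n)| ≤ ∑_{t ∈ T} |∑_{n ≡ t (q)} F(n)| ≤ #T · max_t |∑_{n ≡ t (q)} F(n)|`.

Everything is PROVED (theorems only; no definitions, no named facts).

## References

* D. H. J. Polymath, arXiv:1402.0811: (5.22)–(5.23) and the sentence after (5.22); proof of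
  Proposition 5.10. [cite: Polymath8a2014, §5.3 (5.22) and Proposition 5.10, proof]
-/

noncomputable section

open Finset
open scoped ComplexConjugate

namespace Literature.NumberTheory.Sieve

namespace Polymath8a

/-! ### Conjugation -/

section Conj

variable {d : ℕ} [NeZero d]

/-- The conjugate of a value of the standard additive character. [folklore] -/
theorem conj_stdAddChar (x : ZMod d) : conj (ZMod.stdAddChar x : ℂ) = ZMod.stdAddChar (-x) := by
  rw [AddChar.map_neg_eq_inv]
  have h1 : ‖(ZMod.stdAddChar x : ℂ)‖ = 1 := by rw [ZMod.stdAddChar_apply, Circle.norm_coe]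
  exact (Complex.inv_eq_conj h1).symm

/-- `\overline{e_d(c/m)} = e_d((−c)/m)`. [folklore] -/
theorem conj_eFrac (c m : ℤ) : conj (eFrac d c m) = eFrac d (-c) m := by
  by_cases h : IsUnit (m : ZMod d)
  · rw [eFrac_of_isUnit h, eFrac_of_isUnit h, conj_stdAddChar]
    congr 1; push_cast; ring
  · rw [eFrac_of_not_isUnit h, eFrac_of_not_isUnit h, map_zero]

end Conj

/-! ### Combining two one-pole phases at the same pole -/

/-- **`e_{m₁}(A/n) e_{m₂}(B/n) = e_{m₁m₂}((Am₂ + Bm₁)/n)`** for coprime `m₁, m₂` (Lemma 4.4 read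
backwards: `e_{m₁m₂}(c/n) = e_{m₁}(c/(m₂n)) e_{m₂}(c/(m₁n)) = e_{m₁}((c m̄₂)/n) e_{m₂}((c m̄₁)/n)` and
`c = Am₂ + Bm₁` has `c m̄₂ ≡ A (m₁)`, `c m̄₁ ≡ B (m₂)`).
[cite: Polymath8a2014, Lemma 4.4 and Proposition 5.10, proof] -/
theorem eFrac_mul_eFrac_of_coprime_moduli {m₁ m₂ : ℕ} [NeZero m₁] [NeZero m₂] (h : m₁.Coprime m₂)
    (A B n : ℤ) :
    eFrac m₁ A n * eFrac m₂ B n = eFrac (m₁ * m₂) (A * m₂ + B * m₁) n := by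
  -- inverses of `m₂ (mod m₁)` and `m₁ (mod m₂)`
  have hZ : IsCoprime (m₁ : ℤ) (m₂ : ℤ) := Nat.isCoprime_iff_coprime.mpr h
  obtain ⟨x, y, hxy⟩ := hZ
  -- `x m₁ + y m₂ = 1`
  have hy : ((m₂ : ℤ) : ZMod m₁) * (y : ZMod m₁) = 1 := by
    have := congrArg (fun z : ℤ => (z : ZMod m₁)) hxy
    push_cast at this
    rw [ZMod.natCast_self, mul_zero, zero_add] at this
    rw [Int.cast_natCast, mul_comm]; exact this
  have hx : ((m₁ : ℤ) : ZMod m₂) * (x : ZMod m₂) = 1 := by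
    have := congrArg (fun z : ℤ => (z : ZMod m₂)) hxy
    push_cast at this
    rw [ZMod.natCast_self, mul_zero, add_zero] at this
    rw [Int.cast_natCast, mul_comm]; exact this
  rw [eFrac_mul_of_coprime h, eFrac_unit_mul hy, eFrac_unit_mul hx]
  congr 1
  · refine eFrac_congr_left ?_ n
    push_cast
    have hy' : (m₂ : ZMod m₁) * (y : ZMod m₁) = 1 := by exact_mod_cast hy
    rw [ZMod.natCast_self]
    linear_combination (-(A : ZMod m₁)) * hy'
  · refine eFrac_congr_left ?_ n
    push_cast
    have hx' : (m₁ : ZMod m₂) * (x : ZMod m₂) = 1 := by exact_mod_cast hx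
    rw [ZMod.natCast_self]
    linear_combination (-(B : ZMod m₂)) * hx'

/-! ### Counting the solutions of a linear congruence -/

/-- **`#{n mod q : an ≡ 0} = (a, q)`**: the residues `n ∈ [0, q)` with `q ∣ an` are the multiples of
`q/(a, q)`. [folklore] -/
theorem card_filter_mul_eq_zero (q : ℕ) (hq : q ≠ 0) (a : ℕ) :
    ((Finset.range q).filter fun n : ℕ => q ∣ a * n).card = Nat.gcd a q := by
  set g := Nat.gcd a q with hg
  have hgq : g ∣ q := Nat.gcd_dvd_right a q
  have hg0 : g ≠ 0 := Nat.gcd_ne_zero_right hq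
  obtain ⟨q', hq'⟩ := hgq
  have hq'0 : q' ≠ 0 := by rintro rfl; exact hq (by rw [hq', mul_zero])
  -- `q ∣ a n ↔ q' ∣ n`
  have hiff : ∀ n : ℕ, q ∣ a * n ↔ q' ∣ n := by
    intro n
    obtain ⟨a', ha'⟩ := Nat.gcd_dvd_left a q
    have hcop : Nat.Coprime q' a' := by
      have h1 : Nat.Coprime (q / g) (a / g) := Nat.coprime_div_gcd_div_gcd (Nat.pos_of_ne_zero hg0) |>.symm
      rw [hq', ha', Nat.mul_div_cancel_left _ (Nat.pos_of_ne_zero hg0),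
        Nat.mul_div_cancel_left _ (Nat.pos_of_ne_zero hg0)] at h1
      exact h1
    rw [hq', ha', mul_assoc]
    rw [Nat.mul_dvd_mul_iff_left (Nat.pos_of_ne_zero hg0)]
    exact ⟨fun hd => hcop.dvd_of_dvd_mul_left hd, fun hd => hd.mul_left a'⟩
  have hset : (Finset.range q).filter (fun n : ℕ => q ∣ a * n) =
      (Finset.range g).image (fun k => q' * k) := by
    ext n
    simp only [Finset.mem_filter, Finset.mem_range, Finset.mem_image, hiff]
    constructor
    · rintro ⟨hn, ⟨k, rfl⟩⟩
      refine ⟨k, ?_, rfl⟩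
      rw [hq'] at hn
      nlinarith [Nat.pos_of_ne_zero hq'0]
    · rintro ⟨k, hk, rfl⟩
      refine ⟨?_, dvd_mul_right _ _⟩
      rw [hq']
      nlinarith [Nat.pos_of_ne_zero hq'0]
  rw [hset, Finset.card_image_of_injective _ (fun k₁ k₂ hk => mul_left_cancel₀ hq'0 hk),
    Finset.card_range]

/-- The integer form: `#{n mod q : q ∣ an} = (a, q)` for `a ∈ ℤ`. [folklore] -/
theorem card_filter_int_mul_eq_zero (q : ℕ) (hq : q ≠ 0) (a : ℤ) :
    ((Finset.range q).filter fun n : ℕ => (q : ℤ) ∣ a * n).card = Int.gcd a q := by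
  rw [Int.gcd_eq_natAbs, Int.natAbs_natCast, ← card_filter_mul_eq_zero q hq a.natAbs]
  congr 1
  ext n
  simp only [Finset.mem_filter, and_congr_right_iff]
  intro _
  rw [Int.natCast_dvd, Int.natAbs_mul, Int.natAbs_natCast]

/-- **The solutions of `an ≡ b (mod q)` in `[0, q)`**: there are at most `(a, q)` of them, and if there
is one then `(a, q) ∣ (b, q)` (the solution set is a translate of `{n : q ∣ an}`). [folklore] -/
theorem card_filter_mul_sub_le (q : ℕ) (hq : q ≠ 0) (a b : ℤ) :
    ((Finset.range q).filter fun n : ℕ => (q : ℤ) ∣ a * n - b).card ≤ Int.gcd a q ∧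
      (((Finset.range q).filter fun n : ℕ => (q : ℤ) ∣ a * n - b).Nonempty → Int.gcd a q ∣ Int.gcd b q) := by
  set Sol := (Finset.range q).filter fun n : ℕ => (q : ℤ) ∣ a * n - b with hSol
  by_cases hne : Sol.Nonempty
  · obtain ⟨n₀, hn₀⟩ := hne
    rw [Finset.mem_filter, Finset.mem_range] at hn₀
    obtain ⟨hn₀q, hdiv₀⟩ := hn₀
    refine ⟨?_, fun _ => ?_⟩
    · -- translate by `-n₀` into the kernel
      rw [← card_filter_int_mul_eq_zero q hq a]
      refine Finset.card_le_card_of_injOn (fun n => (n + (q - n₀)) % q) (fun n hn => ?_) ?_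
      · rw [Finset.mem_coe, Finset.mem_filter, Finset.mem_range] at hn ⊢
        refine ⟨Nat.mod_lt _ (Nat.pos_of_ne_zero hq), ?_⟩
        -- `a ((n + q - n₀) mod q) ≡ a n - a n₀ ≡ b - b (mod q)`
        set m : ℕ := n + (q - n₀) with hm
        have h1 : (q : ℤ) ∣ a * (m : ℤ) := by
          have : (m : ℤ) = (n : ℤ) - n₀ + q := by
            rw [hm]; push_cast [Nat.cast_sub hn₀q.le]; ring
          rw [this, show a * ((n : ℤ) - n₀ + q) = (a * n - b) - (a * n₀ - b) + q * a by ring]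
          exact Dvd.dvd.add (Dvd.dvd.sub hn.2 hdiv₀) (dvd_mul_right _ _)
        have hdecomp : ((m % q : ℕ) : ℤ) = (m : ℤ) - (q : ℤ) * ((m / q : ℕ) : ℤ) := by
          have h' : ((m % q : ℕ) : ℤ) + (q : ℤ) * ((m / q : ℕ) : ℤ) = m := by
            exact_mod_cast Nat.mod_add_div m q
          linarith
        rw [hdecomp, show a * ((m : ℤ) - (q : ℤ) * ((m / q : ℕ) : ℤ)) = a * m - q * (a * ((m / q : ℕ) : ℤ)) by ring]
        exact h1.sub (dvd_mul_right _ _)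
      · intro n₁ hn₁ n₂ hn₂ heq
        rw [Finset.mem_coe, Finset.mem_filter, Finset.mem_range] at hn₁ hn₂
        have hm : (n₁ + (q - n₀)) % q = (n₂ + (q - n₀)) % q := heq
        have := Nat.ModEq.add_right_cancel' (q - n₀) hm
        exact Nat.ModEq.eq_of_lt_of_lt this hn₁.1 hn₂.1
    · -- divisibility
      have hg : (Int.gcd a q : ℤ) ∣ b := by
        have h1 : (Int.gcd a q : ℤ) ∣ a * n₀ := (Int.gcd_dvd_left a q).mul_right _
        have h2 : (Int.gcd a q : ℤ) ∣ a * n₀ - b := (Int.gcd_dvd_right a q).trans hdiv₀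
        have := h1.sub h2
        simpa using this
      exact Int.natCast_dvd_natCast.mp (Int.dvd_coe_gcd hg (Int.gcd_dvd_right a q))
  · rw [Finset.not_nonempty_iff_eq_empty] at hne
    refine ⟨by rw [hne, Finset.card_empty]; exact Nat.zero_le _, fun h => absurd h (by rw [hne]; simp)⟩

/-- **The cutoff `C(n)` is supported on at most `(q₀, ℓ)` classes** ((5.22) and the sentence after it:
"since `q₀` is coprime to `rb₁`, this is the characteristic function of a union of at most
`(b₁ − b₂, q₀, ℓrb₁) ≤ (q₀, ℓ)` congruence classes modulo `q₀`"): for `b₁, r` coprime to `q₀`,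
`#{n mod q₀ : b₁(n + ℓr) ≡ b₂ n (mod q₀)} ≤ (ℓ, q₀)`. [cite: Polymath8a2014, §5.3, (5.22)] -/
theorem card_cutoff_le {q₀ : ℕ} (hq₀ : q₀ ≠ 0) {b₁ r : ℤ} (hb₁ : IsCoprime b₁ q₀) (hr : IsCoprime r q₀)
    (b₂ ℓ : ℤ) :
    ((Finset.range q₀).filter fun n : ℕ => (q₀ : ℤ) ∣ b₁ * (n + ℓ * r) - b₂ * n).card ≤ Int.gcd ℓ q₀ := by
  have hset : ((Finset.range q₀).filter fun n : ℕ => (q₀ : ℤ) ∣ b₁ * (n + ℓ * r) - b₂ * n) =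
      (Finset.range q₀).filter fun n : ℕ => (q₀ : ℤ) ∣ (b₁ - b₂) * n - (-(b₁ * (ℓ * r))) := by
    refine Finset.filter_congr fun n _ => ?_
    rw [show b₁ * ((n : ℤ) + ℓ * r) - b₂ * n = (b₁ - b₂) * n - (-(b₁ * (ℓ * r))) by ring]
  rw [hset]
  obtain ⟨hcard, hdvd⟩ := card_filter_mul_sub_le q₀ hq₀ (b₁ - b₂) (-(b₁ * (ℓ * r)))
  by_cases hne : ((Finset.range q₀).filter fun n : ℕ => (q₀ : ℤ) ∣ (b₁ - b₂) * n - (-(b₁ * (ℓ * r)))).Nonempty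
  · have h1 := hdvd hne
    have hgcd : Int.gcd (-(b₁ * (ℓ * r))) q₀ = Int.gcd ℓ q₀ := by
      rw [Int.gcd_eq_natAbs, Int.natAbs_neg, ← Int.gcd_eq_natAbs,
        show b₁ * (ℓ * r) = ℓ * r * b₁ by ring, int_gcd_mul_right_of_isCoprime _ hb₁,
        int_gcd_mul_right_of_isCoprime _ hr]
    rw [hgcd] at h1
    have hpos : 0 < Int.gcd ℓ q₀ := Nat.pos_of_ne_zero (by
      rw [Ne, Int.gcd_eq_zero_iff]; exact fun h => hq₀ (by exact_mod_cast h.2))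
    exact hcard.trans (Nat.le_of_dvd hpos h1)
  · rw [Finset.not_nonempty_iff_eq_empty] at hne
    rw [hne, Finset.card_empty]; exact Nat.zero_le _

/-! ### Splitting a sum over a union of residue classes -/

/-- Among `t < q` at most one is `≡ n (mod q)`. [folklore] -/
theorem residue_unique {q : ℕ} {t₁ t₂ : ℕ} (ht₁ : t₁ < q) (ht₂ : t₂ < q) {n : ℤ}
    (h₁ : (q : ℤ) ∣ n - t₁) (h₂ : (q : ℤ) ∣ n - t₂) : t₁ = t₂ := by
  have h : (q : ℤ) ∣ (t₂ : ℤ) - t₁ := by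
    have := h₁.sub h₂; rwa [show n - (t₁ : ℤ) - (n - t₂) = t₂ - t₁ by ring] at this
  have h' : (t₁ : ℤ) ≡ t₂ [ZMOD (q : ℤ)] := Int.modEq_iff_dvd.mpr h
  have h'' : t₁ ≡ t₂ [MOD q] := Int.natCast_modEq_iff.mp h'
  exact Nat.ModEq.eq_of_lt_of_lt h'' ht₁ ht₂

/-- **Splitting the cutoff sum over its classes**: for a set `T` of residues `t < q` and a summable `F`,
`∑_n 1_{∃ t ∈ T, n ≡ t (q)} F(n) = ∑_{t ∈ T} ∑_n 1_{n ≡ t (q)} F(n)`, whence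
`|∑_n C(n) F(n)| ≤ ∑_{t ∈ T} |∑_{n ≡ t (q)} F(n)| ≤ #T · max_t |∑_{n ≡ t (q)} F(n)|`
("`|S_{ℓ,r}| ≤ (q₀,ℓ) max_{t ∈ ℤ/q₀ℤ} |∑_{n = t (q₀)} ψ_N(n) Φ₁(n) \overline{Φ₂(n)}|`").
[cite: Polymath8a2014, Proposition 5.10, proof] -/
theorem tsum_indicator_classes_eq {q : ℕ} {T : Finset ℕ} (hT : ∀ t ∈ T, t < q) {F : ℤ → ℂ}
    (hF : Summable F) :
    ∑' n : ℤ, (if ∃ t ∈ T, (q : ℤ) ∣ n - t then F n else 0) =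
      ∑ t ∈ T, ∑' n : ℤ, (if (q : ℤ) ∣ n - t then F n else 0) := by
  classical
  have hsum : ∀ t ∈ T, Summable fun n : ℤ => (if (q : ℤ) ∣ n - t then F n else 0) := by
    intro t _
    refine Summable.of_norm_bounded hF.norm fun n => ?_
    split_ifs <;> simp
  rw [← Summable.tsum_finsetSum hsum]
  refine tsum_congr fun n => ?_
  by_cases h : ∃ t ∈ T, (q : ℤ) ∣ n - t
  · obtain ⟨t₀, ht₀, hdt₀⟩ := h
    rw [if_pos ⟨t₀, ht₀, hdt₀⟩, ← Finset.add_sum_erase T _ ht₀, if_pos hdt₀]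
    rw [Finset.sum_eq_zero fun t ht => ?_, add_zero]
    rw [Finset.mem_erase] at ht
    rw [if_neg]
    intro hdt
    exact ht.1 (residue_unique (hT t ht.2) (hT t₀ ht₀) hdt hdt₀)
  · rw [if_neg h]
    symm
    refine Finset.sum_eq_zero fun t ht => ?_
    rw [if_neg fun hdt => h ⟨t, ht, hdt⟩]

/-- The triangle-inequality consequence: `|∑_n C(n)F(n)| ≤ ∑_{t ∈ T} |∑_{n ≡ t (q)} F(n)|`.
[cite: Polymath8a2014, Proposition 5.10, proof] -/
theorem norm_tsum_indicator_classes_le {q : ℕ} {T : Finset ℕ} (hT : ∀ t ∈ T, t < q) {F : ℤ → ℂ}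
    (hF : Summable F) :
    ‖∑' n : ℤ, (if ∃ t ∈ T, (q : ℤ) ∣ n - t then F n else 0)‖ ≤
      ∑ t ∈ T, ‖∑' n : ℤ, (if (q : ℤ) ∣ n - t then F n else 0)‖ := by
  rw [tsum_indicator_classes_eq hT hF]
  exact norm_sum_le _ _

end Polymath8a

end Literature.NumberTheory.Sieve
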